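import Mathlib
import Summits.HodgeConjecture.HodgeConjecture.Theorems.F0P2wThetaShapeOfWeight
import HarnessLib

/-!
# FLOOR-0 P2, ROAD-W organ (L8) «WEIGHT ⇒ SCALAR»: a semisimple operator killed by a polynomial with exactly one root of the
# operator's weight acts by that root — the OPERATOR side of ROAD-W v1 §2 W3 (★ L2 `F0P2wThetaShapeOfWeight` is the MULTISET side)

Generic linear algebra (Mathlib-only content; upstream candidate), parked under `Theorems/` as a count-neutral helper of crux H413 =
`stmt-HodgeConjecture-24833` (`F0/P2/ROAD-W.v1.F0P2-plan-g15.md` 239b1f58 §2 W3, `F0/P2/p02/g18/ROADW-W4-KERNEL-LEDGER.v1` a7961ba7).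

THE MATHEMATICS.  Let `T` be an endomorphism of a `K`-vector space `V` and `p ∈ K[X]` with `p(T) = 0`.
* (i) every eigenvalue of `T` is a root of `p` (`isRoot_of_hasEigenvalue_of_aeval_eq_zero`; Mathlib has the `minpoly` case only,
  `Module.End.isRoot_of_hasEigenvalue`); (ii) over an algebraically closed field, `V ≠ 0` finite-dimensional, SOME root of `p` is an
  eigenvalue (`exists_hasEigenvalue_isRoot_of_aeval_eq_zero`);
* (iii) eigenvalues of `T − c` are the eigenvalues of `T` shifted by `c` (`eigenspace_sub_algebraMap`, `hasEigenvalue_sub_algebraMap_iff`);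
* (iv) a SEMISIMPLE `T` (finite-dimensional, `K` algebraically closed) all of whose eigenvalues equal `c` IS the scalar `c`
  (`eq_algebraMap_of_isSemisimple_of_forall_hasEigenvalue`, over Mathlib's `Module.End.IsSemisimple.eq_zero_iff_forall_eigenvalue`;
  semisimplicity is load-bearing: a Jordan block has one eigenvalue and is not scalar);
* (v) THE ORGAN `eq_algebraMap_of_isSemisimple_of_aeval_eq_zero`: if every eigenvalue of the semisimple `T` has a property `w`
  («weight») and `c` is the only root of the annihilating polynomial `p` with property `w`, then `T = c · id`.
* (vi) `ℂ`-specialisations at the Hecke-type polynomial `∏_{a ∈ M} (X − q·a)` with weights = norms: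
  (vi-a) `exists_mem_norm_eq_inv_sqrt_of_aeval_prod_eq_zero`: if `∏ (T − q·a) = 0` and every eigenvalue of `T` has modulus `√q`, then
  SOME `a ∈ M` has modulus `(√q)⁻¹` — the weight hypothesis `hα` of ★ L2 `thetaShape_of_weight` TOKEN FOR TOKEN;
  (vi-b) `eq_algebraMap_of_thetaShape`: in theta shape `M = {u·√q, u·(√q)⁻¹, w}` (`‖u‖ = ‖w‖ = 1`, `1 < q`) the roots `q·a` have moduli
  `q√q`, `√q`, `q`, so the only root of modulus `√q` is `q·u·(√q)⁻¹ = u·√q`, and a semisimple `T` of weight `√q` killed by the product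
  IS `u·√q · id`; (vi-c) `exists_thetaShape_and_eq_algebraMap` = (vi-a) ∘ ★ `thetaShape_of_weight` ∘ (vi-b) BY NAME.

MODEL USE (ROAD-W §2 W3, words of the memo): `V = H¹[σ]` (the `σ`-isotypic part of `H¹` of the Picard-type surface, over `ℚ̄_ℓ ≅ ℂ`),
`T = Frob_𝔮` — SEMISIMPLE with all eigenvalues of modulus `q^{1/2}` by W1 (Weil purity + semisimplicity of Frobenius on `H¹` of an
abelian variety, PRINT), killed by the Hecke polynomial `H_𝔮 = ∏ (X − q·αᵢ)` at `σ`'s Satake parameter `{αᵢ}` by W2 (congruence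
relation, PRINT); unitarity makes `{αᵢ}` conjugate-inverse stable.  Then (vi-c): `{αᵢ}` is the THETA SHAPE and `Frob_𝔮` acts on
`H¹[σ]` by the SCALAR `u·q^{1/2}` — «the other roots have the wrong weight».  W1, W2 stay PRINT; this file is the generic glue between
them and ★ L1 (`F0P2wScalarOfDense`) ∕ ★ L2 (`F0P2wThetaShapeOfWeight`), nothing more.  THEOREMS ONLY; imports Mathlib + ★ L2 + HarnessLib.

Cell hodgecm-mathlib (D-0151), FLOOR 0; seat F0P2-p02 (g20), census-first default announced on the P2∕P3 buses 13:59:55Z; lane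
`--kind proof --supports stmt-HodgeConjecture-24833 --as helper`; touches no registry and no served Line.
HONEST LABEL: HC_CM is proved only modulo the printed citations (hLiu418 = `stmt-HodgeConjecture-24832`, h413 = `stmt-HodgeConjecture-24833`)
until rung 0 closes; this file proves nothing about them (count-neutral).  [folklore]

## References
* [HoffmanKunze1971LinearAlgebra] K. Hoffman, R. Kunze, *Linear Algebra*, 2nd ed. (1971), §6.2 (characteristic values; a
  diagonalizable operator with a single characteristic value is scalar) and §6.3 (annihilating polynomials).
-/

set_option autoImplicit false
-- the mandated namespace repeats `HodgeConjecture.HodgeConjecture`, as in every `Theorems/*.lean` of this sub-problem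
set_option linter.dupNamespace false

namespace Summit.HodgeConjecture.HodgeConjecture.Cruxes.H413.F0P2wWeightScalar

open Polynomial

section Generic

variable {K V : Type*} [Field K] [AddCommGroup V] [Module K V]

/-- (i) **Eigenvalues are roots of ANY annihilating polynomial**: if `p(T) = 0` and `μ` is an eigenvalue of `T` then `p(μ) = 0`
(apply `p(T)` to an eigenvector: `p(T) x = p(μ) • x`). [folklore] -/
theorem isRoot_of_hasEigenvalue_of_aeval_eq_zero {T : Module.End K V} {p : K[X]} (hp : aeval T p = 0)
    {μ : K} (hμ : T.HasEigenvalue μ) : p.IsRoot μ := by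
  obtain ⟨x, hx⟩ := hμ.exists_hasEigenvector
  have h := Module.End.aeval_apply_of_hasEigenvector (p := p) hx
  rw [hp, LinearMap.zero_apply] at h
  exact (smul_eq_zero.mp h.symm).resolve_right hx.2

/-- (ii) Over an algebraically closed field, on a non-zero finite-dimensional space, an annihilating polynomial of `T` has a root
which is an eigenvalue of `T`. [folklore] -/
theorem exists_hasEigenvalue_isRoot_of_aeval_eq_zero [IsAlgClosed K] [FiniteDimensional K V] [Nontrivial V]
    {T : Module.End K V} {p : K[X]} (hp : aeval T p = 0) :
    ∃ μ : K, T.HasEigenvalue μ ∧ p.IsRoot μ := by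
  obtain ⟨μ, hμ⟩ := Module.End.exists_eigenvalue T
  exact ⟨μ, hμ, isRoot_of_hasEigenvalue_of_aeval_eq_zero hp hμ⟩

/-- (iii) The `ν`-eigenspace of `T − c` is the `(ν + c)`-eigenspace of `T` (membership form). [folklore] -/
theorem mem_eigenspace_sub_algebraMap_iff {T : Module.End K V} {c ν : K} {x : V} :
    x ∈ (T - algebraMap K (Module.End K V) c).eigenspace ν ↔ x ∈ T.eigenspace (ν + c) := by
  simp only [Module.End.mem_eigenspace_iff, LinearMap.sub_apply, Module.algebraMap_end_apply,
    sub_eq_iff_eq_add, add_smul]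

/-- (iii) The `ν`-eigenspace of `T − c` is the `(ν + c)`-eigenspace of `T`. [folklore] -/
theorem eigenspace_sub_algebraMap (T : Module.End K V) (c ν : K) :
    (T - algebraMap K (Module.End K V) c).eigenspace ν = T.eigenspace (ν + c) :=
  Submodule.ext fun _ => mem_eigenspace_sub_algebraMap_iff

/-- (iii) `ν` is an eigenvalue of `T − c` iff `ν + c` is an eigenvalue of `T`. [folklore] -/
theorem hasEigenvalue_sub_algebraMap_iff {T : Module.End K V} {c ν : K} :
    (T - algebraMap K (Module.End K V) c).HasEigenvalue ν ↔ T.HasEigenvalue (ν + c) := by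
  rw [Module.End.hasEigenvalue_iff, Module.End.hasEigenvalue_iff, eigenspace_sub_algebraMap]

/-- On a non-zero space the scalar operator `c` has exactly the eigenvalue `c`. [folklore] -/
theorem hasEigenvalue_algebraMap_iff [Nontrivial V] {c μ : K} :
    (algebraMap K (Module.End K V) c).HasEigenvalue μ ↔ μ = c := by
  rw [Module.End.hasEigenvalue_iff, ne_eq, Submodule.eq_bot_iff, not_forall]
  constructor
  · rintro ⟨x, hx⟩
    rw [Classical.not_imp] at hx
    obtain ⟨hx, hx0⟩ := hx
    rw [Module.End.mem_eigenspace_iff, Module.algebraMap_end_apply] at hx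
    by_contra hne
    exact hx0 (by
      have h : (c - μ) • x = 0 := by rw [sub_smul, hx, sub_self]
      exact (smul_eq_zero.mp h).resolve_left (sub_ne_zero.mpr (Ne.symm hne)))
  · rintro rfl
    obtain ⟨x, hx⟩ := exists_ne (0 : V)
    refine ⟨x, ?_⟩
    rw [Classical.not_imp]
    exact ⟨by rw [Module.End.mem_eigenspace_iff, Module.algebraMap_end_apply], hx⟩

/-- (iv) **A semisimple operator with a single eigenvalue is scalar** (`K` algebraically closed, `V` finite-dimensional): if every
eigenvalue of the semisimple `T` equals `c`, then `T = c · id`.  (Apply Mathlib's `IsSemisimple.eq_zero_iff_forall_eigenvalue` to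
`T − c`, which is semisimple with all eigenvalues `0`.)  Semisimplicity is load-bearing (a Jordan block). [folklore] -/
theorem eq_algebraMap_of_isSemisimple_of_forall_hasEigenvalue [IsAlgClosed K] [FiniteDimensional K V]
    {T : Module.End K V} (hs : T.IsSemisimple) {c : K} (h : ∀ μ : K, T.HasEigenvalue μ → μ = c) :
    T = algebraMap K (Module.End K V) c := by
  have hs' : (T - algebraMap K (Module.End K V) c).IsSemisimple :=
    Module.End.isSemisimple_sub_algebraMap_iff.mpr hs
  have h0 : T - algebraMap K (Module.End K V) c = 0 := by
    rw [hs'.eq_zero_iff_forall_eigenvalue]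
    intro ν hν
    have hνc : ν + c = c := h (ν + c) (hasEigenvalue_sub_algebraMap_iff.mp hν)
    simpa using hνc
  exact sub_eq_zero.mp h0

/-- (v) **THE ORGAN «WEIGHT ⇒ SCALAR».**  `K` algebraically closed, `V` finite-dimensional, `T` semisimple with `p(T) = 0`; suppose
every eigenvalue of `T` has a property `w` (its «weight») and `c` is the only root of `p` with property `w`.  Then `T = c · id`:
each eigenvalue is a root of `p` (i) of weight `w`, hence equals `c`, and (iv) applies. [folklore] -/
theorem eq_algebraMap_of_isSemisimple_of_aeval_eq_zero [IsAlgClosed K] [FiniteDimensional K V]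
    {T : Module.End K V} (hs : T.IsSemisimple) {p : K[X]} (hp : aeval T p = 0)
    (w : K → Prop) (hw : ∀ μ : K, T.HasEigenvalue μ → w μ) {c : K}
    (hc : ∀ x : K, p.IsRoot x → w x → x = c) : T = algebraMap K (Module.End K V) c :=
  eq_algebraMap_of_isSemisimple_of_forall_hasEigenvalue hs fun μ hμ =>
    hc μ (isRoot_of_hasEigenvalue_of_aeval_eq_zero hp hμ) (hw μ hμ)

/-- (v′) Converse bookkeeping: the scalar operator `c` is semisimple, is killed by `X − C c`, and (on `V ≠ 0`) its eigenvalues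
all equal `c` — so (v) is sharp. [folklore] -/
theorem isSemisimple_algebraMap_and_aeval_eq_zero [FiniteDimensional K V] (c : K) :
    (algebraMap K (Module.End K V) c).IsSemisimple ∧ aeval (algebraMap K (Module.End K V) c) (X - C c) = 0 := by
  refine ⟨?_, by simp⟩
  apply Module.End.isSemisimple_of_squarefree_aeval_eq_zero (p := X - C c)
  · exact Irreducible.squarefree (irreducible_X_sub_C c)
  · simp

end Generic

section Complex

open ComplexConjugate

variable {V : Type*} [AddCommGroup V] [Module ℂ V]

/-- Roots of the Hecke-type polynomial `∏_{a ∈ M} (X − q·a)` are the `q·a`, `a ∈ M`. [folklore] -/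
theorem isRoot_prod_X_sub_C_mul_iff (M : Multiset ℂ) (q x : ℂ) :
    ((M.map fun a => X - C (q * a)).prod).IsRoot x ↔ ∃ a ∈ M, x = q * a := by
  rw [Polynomial.IsRoot.def, Polynomial.eval_multiset_prod, Multiset.map_map, Multiset.prod_eq_zero_iff,
    Multiset.mem_map]
  simp only [Function.comp_apply, eval_sub, eval_X, eval_C, sub_eq_zero]

/-- The modulus of `q·a` for real `q ≥ 0`: `‖q·a‖ = q·‖a‖` (private: the same one-liner exists in other summit trees). [folklore] -/
private theorem norm_ofReal_mul {q : ℝ} (hq : 0 ≤ q) (a : ℂ) : ‖(q : ℂ) * a‖ = q * ‖a‖ := by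
  rw [norm_mul, Complex.norm_real, Real.norm_of_nonneg hq]

/-- (vi-a) **The weight input of ★ L2 from an annihilating Hecke-type polynomial.**  `V ≠ 0` finite-dimensional over `ℂ`, `0 < q`;
if `∏_{a ∈ M} (T − q·a) = 0` and every eigenvalue of `T` has modulus `√q`, then some `a ∈ M` has modulus `(√q)⁻¹` — the
hypothesis `hα` of `F0P2wThetaShapeOfWeight.thetaShape_of_weight` token for token.  (Some eigenvalue `μ` exists and is a root,
`μ = q·a`; `q·‖a‖ = √q` gives `‖a‖ = √q/q = (√q)⁻¹`.) [folklore] -/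
theorem exists_mem_norm_eq_inv_sqrt_of_aeval_prod_eq_zero [FiniteDimensional ℂ V] [Nontrivial V]
    {T : Module.End ℂ V} {q : ℝ} (hq : 0 < q) {M : Multiset ℂ}
    (hp : aeval T ((M.map fun a => X - C ((q : ℂ) * a)).prod) = 0)
    (hw : ∀ μ : ℂ, T.HasEigenvalue μ → ‖μ‖ = Real.sqrt q) :
    ∃ a ∈ M, ‖a‖ = (Real.sqrt q)⁻¹ := by
  obtain ⟨μ, hμ, hroot⟩ := exists_hasEigenvalue_isRoot_of_aeval_eq_zero hp
  obtain ⟨a, ha, rfl⟩ := (isRoot_prod_X_sub_C_mul_iff M q μ).mp hroot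
  refine ⟨a, ha, ?_⟩
  have h : q * ‖a‖ = Real.sqrt q := by rw [← norm_ofReal_mul hq.le]; exact hw _ hμ
  have hsq : Real.sqrt q ≠ 0 := (Real.sqrt_pos.mpr hq).ne'
  apply eq_inv_of_mul_eq_one_left
  apply mul_left_cancel₀ hsq
  calc Real.sqrt q * (‖a‖ * Real.sqrt q) = (Real.sqrt q * Real.sqrt q) * ‖a‖ := by ring
    _ = q * ‖a‖ := by rw [Real.mul_self_sqrt hq.le]
    _ = Real.sqrt q := h
    _ = Real.sqrt q * 1 := (mul_one _).symm

/-- The moduli of the three roots `q·a` in theta shape: `‖q·(u√q)‖ = q√q`, `‖q·(u(√q)⁻¹)‖ = √q`, `‖q·w‖ = q`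
(`‖u‖ = ‖w‖ = 1`, `0 < q`). [folklore] -/
theorem norm_mul_thetaShape_entries {q : ℝ} (hq : 0 < q) {u w : ℂ} (hu : ‖u‖ = 1) (hw : ‖w‖ = 1) :
    ‖(q : ℂ) * (u * (Real.sqrt q : ℂ))‖ = q * Real.sqrt q ∧
      ‖(q : ℂ) * (u * (Real.sqrt q : ℂ)⁻¹)‖ = Real.sqrt q ∧ ‖(q : ℂ) * w‖ = q := by
  obtain ⟨h1, h2⟩ := F0P2wThetaShapeOfWeight.norm_thetaShape_entries q hu
  have hsq : Real.sqrt q ≠ 0 := (Real.sqrt_pos.mpr hq).ne'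
  refine ⟨by rw [norm_ofReal_mul hq.le, h1], ?_, by rw [norm_ofReal_mul hq.le, hw, mul_one]⟩
  rw [norm_ofReal_mul hq.le, h2, mul_inv_eq_iff_eq_mul₀ hsq]
  exact (Real.mul_self_sqrt hq.le).symm

/-- In theta shape the middle root IS `u·√q`: `q · (u·(√q)⁻¹) = u·√q` (`0 < q`). [folklore] -/
theorem ofReal_mul_mul_inv_sqrt {q : ℝ} (hq : 0 < q) (u : ℂ) :
    (q : ℂ) * (u * (Real.sqrt q : ℂ)⁻¹) = u * (Real.sqrt q : ℂ) := by
  have hsq : (Real.sqrt q : ℂ) ≠ 0 := by exact_mod_cast (Real.sqrt_pos.mpr hq).ne'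
  have hqC : (q : ℂ) = (Real.sqrt q : ℂ) * (Real.sqrt q : ℂ) := by
    rw [← Complex.ofReal_mul, Real.mul_self_sqrt hq.le]
  rw [hqC]
  field_simp

/-- (vi-b) **Frobenius is scalar in theta shape.**  `V` finite-dimensional over `ℂ`, `1 < q`, `‖u‖ = ‖w‖ = 1`; if the semisimple `T`
is killed by `∏_{a ∈ {u√q, u(√q)⁻¹, w}} (X − q·a)` and all its eigenvalues have modulus `√q`, then `T = u·√q · id` — the roots have
moduli `q√q`, `√q`, `q` and `q ≠ 1` makes `u·√q` the only one of modulus `√q` ((v) with `w := (‖·‖ = √q)`). [folklore] -/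
theorem eq_algebraMap_of_thetaShape [FiniteDimensional ℂ V] {T : Module.End ℂ V} (hs : T.IsSemisimple)
    {q : ℝ} (hq : 1 < q) {u w : ℂ} (hu : ‖u‖ = 1) (hw' : ‖w‖ = 1)
    (hp : aeval T ((({u * (Real.sqrt q : ℂ), u * (Real.sqrt q : ℂ)⁻¹, w} : Multiset ℂ).map
      fun a => X - C ((q : ℂ) * a)).prod) = 0)
    (hw : ∀ μ : ℂ, T.HasEigenvalue μ → ‖μ‖ = Real.sqrt q) :
    T = algebraMap ℂ (Module.End ℂ V) (u * (Real.sqrt q : ℂ)) := by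
  have hq0 : 0 < q := lt_trans zero_lt_one hq
  have hsq1 : 1 < Real.sqrt q := F0P2wThetaShapeOfWeight.one_lt_sqrt hq
  obtain ⟨n1, n2, n3⟩ := norm_mul_thetaShape_entries hq0 hu hw'
  refine eq_algebraMap_of_isSemisimple_of_aeval_eq_zero hs hp (fun z => ‖z‖ = Real.sqrt q) hw ?_
  intro x hx hxn
  obtain ⟨a, ha, rfl⟩ := (isRoot_prod_X_sub_C_mul_iff _ _ x).mp hx
  simp only [Multiset.insert_eq_cons, Multiset.mem_cons, Multiset.mem_singleton] at ha
  rcases ha with rfl | rfl | rfl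
  · -- modulus `q√q ≠ √q`
    exfalso
    rw [n1] at hxn
    have : q = 1 := by
      have h := mul_right_cancel₀ (lt_trans zero_lt_one hsq1).ne' (hxn.trans (one_mul _).symm)
      exact h
    exact (ne_of_gt hq) this
  · exact ofReal_mul_mul_inv_sqrt hq0 u
  · -- modulus `q ≠ √q`
    exfalso
    rw [n3] at hxn
    have h2 : Real.sqrt q * Real.sqrt q = Real.sqrt q * 1 := by rw [Real.mul_self_sqrt hq0.le, mul_one]; exact hxn
    have : Real.sqrt q = 1 := mul_left_cancel₀ (lt_trans zero_lt_one hsq1).ne' h2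
    exact (ne_of_gt hsq1) this

/-- (vi-c) **W3, both sides, BY NAME.**  `V ≠ 0` finite-dimensional over `ℂ`, `T` semisimple with all eigenvalues of modulus `√q`
(`1 < q`), killed by `∏_{a ∈ M} (X − q·a)` for a multiset `M` of three non-zero complex numbers stable under `z ↦ (conj z)⁻¹`.
Then `M` is in THETA SHAPE `{u√q, u(√q)⁻¹, w}` (`‖u‖ = ‖w‖ = 1`) — ★ `F0P2wThetaShapeOfWeight.thetaShape_of_weight` fed by (vi-a) —
AND `T = u·√q · id` (vi-b). [folklore] -/
theorem exists_thetaShape_and_eq_algebraMap [FiniteDimensional ℂ V] [Nontrivial V]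
    {T : Module.End ℂ V} (hs : T.IsSemisimple) {q : ℝ} (hq : 1 < q) {M : Multiset ℂ}
    (hcard : Multiset.card M = 3) (h0 : (0 : ℂ) ∉ M) (hstab : M.map (fun z => (conj z)⁻¹) = M)
    (hp : aeval T ((M.map fun a => X - C ((q : ℂ) * a)).prod) = 0)
    (hw : ∀ μ : ℂ, T.HasEigenvalue μ → ‖μ‖ = Real.sqrt q) :
    ∃ u w : ℂ, ‖u‖ = 1 ∧ ‖w‖ = 1 ∧ M = {u * (Real.sqrt q : ℂ), u * (Real.sqrt q : ℂ)⁻¹, w} ∧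
      T = algebraMap ℂ (Module.End ℂ V) (u * (Real.sqrt q : ℂ)) := by
  have hα : ∃ α ∈ M, ‖α‖ = (Real.sqrt q)⁻¹ :=
    exists_mem_norm_eq_inv_sqrt_of_aeval_prod_eq_zero (lt_trans zero_lt_one hq) hp hw
  obtain ⟨u, w, hu, hw', hM⟩ := F0P2wThetaShapeOfWeight.thetaShape_of_weight hq hcard h0 hstab hα
  refine ⟨u, w, hu, hw', hM, ?_⟩
  subst hM
  exact eq_algebraMap_of_thetaShape hs hq hu hw' hp hw

end Complex

end Summit.HodgeConjecture.HodgeConjecture.Cruxes.H413.F0P2wWeightScalar
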